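import Summits.CriticalPhenomena.PercolationContinuityZ3.Theorems.SahiAEFiniteVersionTransport
import Summits.CriticalPhenomena.PercolationContinuityZ3.Theorems.SahiAEVersionTransportAtoms
import Summits.CriticalPhenomena.PercolationContinuityZ3.Theorems.SahiAEBorelVersionPosPi

/-!
# Finite everywhere-MTP₂ versions of unbounded densities under products of σ-finite measures; the plane

Support file of the Sahi cell (`prim-sahi`, typer seat, generation 22; `--supports stmt-CriticalPhenomena-4575`).
Theorems only (no definitions, no named facts, no sorries).

Completion of the transport of `SahiAEFiniteVersionTransport.lean`:

* `HasFiniteMTP2Versions.pi_of_restrict_openUnitCube'` — Lebesgue on the open cube ⟹ every finite product of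
  probability measures on `ℝ`, atoms allowed, by the fixed section of the randomised probability integral transform
  (as `HasPosBorelMTP2Versions.pi_of_restrict_openUnitCube'`);
* `HasFiniteMTP2Versions.pi_of_volume'` — ⟹ every finite product of σ-finite measures on `ℝ`;
* **`hasFiniteMTP2Versions_pi_plane (ρ : Fin 2 → Measure ℝ) [∀ i, SigmaFinite (ρ i)]`** and the unfolded
  **`Plane.exists_measurable_mtp2_version_of_ae_pi_plane`** (+ `…'` with `0 < f < ∞` only a.e.): for every product
  `ρ₀ ⊗ ρ₁` of σ-finite measures on `ℝ` (atoms allowed), a measurable `f : ℝ² → (0, ∞)` (no bounds) MTP₂ on almost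
  every pair has a FINITE Borel version MTP₂ at EVERY pair (it may vanish off the essential rectangle, so the
  additive form is stated for Lebesgue measure only, `Plane.exists_measurable_supermodular_version_of_ae_plane`).

No sorries, no new axioms.
-/

noncomputable section

namespace Summit.CriticalPhenomena.PercolationContinuityZ3.Theorems.SahiAEFourFunctions

open MeasureTheory Set Filter Topology ProbabilityTheory RealQuantile Function
open scoped ENNReal NNReal

variable {ι : Type*} [Fintype ι]

/-! ### Atoms: fixed section of the randomised probability integral transform -/

/-- **Lebesgue on the open unit cube ⟹ every finite product of probability measures on `ℝ` (atoms allowed)** for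
the finite-version property. [this work] -/
theorem HasFiniteMTP2Versions.pi_of_restrict_openUnitCube'
    (hP : HasFiniteMTP2Versions ((volume : Measure (ι → ℝ)).restrict (Set.pi univ fun _ => Ioo (0 : ℝ) 1)))
    (ν : ι → Measure ℝ) [∀ i, IsProbabilityMeasure (ν i)] : HasFiniteMTP2Versions (Measure.pi ν) := by
  classical
  intro f hf h0 hTop hMTP
  set U : Set (ι → ℝ) := Set.pi univ fun _ => Ioo (0 : ℝ) 1 with hU
  have mU : MeasurableSet U := MeasurableSet.univ_pi fun _ => measurableSet_Ioo
  set μ₁ : Measure (ι → ℝ) := (volume : Measure (ι → ℝ)).restrict U with hμ₁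
  have hμ₁pi : μ₁ = Measure.pi fun _ : ι => (volume : Measure ℝ).restrict (Ioo (0 : ℝ) 1) := by
    rw [hμ₁, hU, volume_pi, Measure.restrict_pi_pi]
  have hμ₁0 : μ₁ ≠ 0 := by
    intro h
    have h1 : μ₁ U = 0 := by rw [h]; rfl
    rw [hμ₁, Measure.restrict_apply_self, hU, volume_pi_pi] at h1
    simp only [Real.volume_Ioo, sub_zero, ENNReal.ofReal_one, Finset.prod_const_one, one_ne_zero] at h1
  haveI : IsFiniteMeasure μ₁ := by
    refine ⟨?_⟩
    rw [hμ₁, Measure.restrict_apply_univ, hU, volume_pi_pi]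
    simp only [Real.volume_Ioo, sub_zero, ENNReal.ofReal_one, Finset.prod_const_one, ENNReal.one_lt_top]
  set T : (ι → ℝ) → (ι → ℝ) := fun u i => rqe (ν i) (u i) with hT
  have hTmp : MeasurePreserving T μ₁ (Measure.pi ν) := by
    rw [hμ₁pi]; exact measurePreserving_pi _ _ fun i => measurePreserving_rqe (ν i)
  have haeU : ∀ᵐ u ∂μ₁, u ∈ U := ae_restrict_mem mU
  have haeU2 : ∀ᵐ p ∂μ₁.prod μ₁, p.1 ∈ U ∧ p.2 ∈ U := by
    filter_upwards [(Measure.quasiMeasurePreserving_fst (μ := μ₁) (ν := μ₁)).ae haeU,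
      (Measure.quasiMeasurePreserving_snd (μ := μ₁) (ν := μ₁)).ae haeU] with p h1 h2 using ⟨h1, h2⟩
  have hTlat : ∀ᵐ p ∂μ₁.prod μ₁, T (p.1 ⊓ p.2) = T p.1 ⊓ T p.2 ∧ T (p.1 ⊔ p.2) = T p.1 ⊔ T p.2 := by
    filter_upwards [haeU2] with p hp
    refine ⟨funext fun i => ?_, funext fun i => ?_⟩
    · exact (monotoneOn_rqe (ν i)).map_inf (Set.mem_univ_pi.1 hp.1 i) (Set.mem_univ_pi.1 hp.2 i)
    · exact (monotoneOn_rqe (ν i)).map_sup (Set.mem_univ_pi.1 hp.1 i) (Set.mem_univ_pi.1 hp.2 i)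
  have hqmp2 : Measure.QuasiMeasurePreserving (Prod.map T T) (μ₁.prod μ₁) ((Measure.pi ν).prod (Measure.pi ν)) :=
    MeasureTheory.QuasiMeasurePreserving.prodMap hTmp.quasiMeasurePreserving hTmp.quasiMeasurePreserving
  have hMTP' : ∀ᵐ p ∂μ₁.prod μ₁, f (T p.1) * f (T p.2) ≤ f (T (p.1 ⊓ p.2)) * f (T (p.1 ⊔ p.2)) := by
    filter_upwards [hqmp2.ae hMTP, hTlat] with p hp hl
    rw [hl.1, hl.2]; exact hp
  obtain ⟨F', hF'm, hF'T, hF'ae, hF'mtp⟩ :=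
    hP (f ∘ T) (hf.comp hTmp.measurable) (fun x => h0 (T x)) (fun x => hTop (T x)) hMTP'
  set θ : (ι → ℝ) → (ι → ℝ) → (ι → ℝ) := fun x v i => rpit (ν i) (x i) (v i) with hθ
  have hθm : Measurable fun q : (ι → ℝ) × (ι → ℝ) => θ q.1 q.2 := by
    refine measurable_pi_iff.2 fun i => ?_
    have hq : Measurable fun q : (ι → ℝ) × (ι → ℝ) => ((q.1 i, q.2 i) : ℝ × ℝ) :=
      ((measurable_pi_apply i).comp measurable_fst).prodMk ((measurable_pi_apply i).comp measurable_snd)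
    show Measurable fun q : (ι → ℝ) × (ι → ℝ) => rpit (ν i) (q.1 i) (q.2 i)
    exact (measurable_rpit (ν i)).comp hq
  set κ : (ι → ℝ) × (ι → ℝ) → (ι → ℝ) := fun q => θ (T q.1) q.2 with hκ
  have hκqmp : Measure.QuasiMeasurePreserving κ (μ₁.prod μ₁) μ₁ := by
    have he := (measurePreserving_arrowProdEquivProdArrow ℝ ℝ ι
      (fun _ : ι => (volume : Measure ℝ).restrict (Ioo (0 : ℝ) 1))
      (fun _ : ι => (volume : Measure ℝ).restrict (Ioo (0 : ℝ) 1))).symm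
    rw [← hμ₁pi] at he
    have hK : Measure.QuasiMeasurePreserving
        (fun (w : ι → ℝ × ℝ) i => rpit (ν i) (rqe (ν i) (w i).1) (w i).2)
        (Measure.pi fun _ : ι => ((volume : Measure ℝ).restrict (Ioo (0 : ℝ) 1)).prod
          ((volume : Measure ℝ).restrict (Ioo (0 : ℝ) 1))) μ₁ := by
      rw [hμ₁pi]
      exact quasiMeasurePreserving_pi_map
        (k := fun i (z : ℝ × ℝ) => rpit (ν i) (rqe (ν i) z.1) z.2)
        fun i => quasiMeasurePreserving_rpit_rqe (ν i)
    have hcomp : κ = (fun (w : ι → ℝ × ℝ) i => rpit (ν i) (rqe (ν i) (w i).1) (w i).2) ∘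
        (MeasurableEquiv.arrowProdEquivProdArrow ℝ ℝ ι).symm := by
      funext q; rfl
    rw [hcomp]
    exact hK.comp he.quasiMeasurePreserving
  have h1 : ∀ᵐ q ∂μ₁.prod μ₁, F' (κ q) = f (T (κ q)) := hκqmp.ae hF'ae
  have h2 : ∀ᵐ q ∂μ₁.prod μ₁, T (κ q) = T q.1 := by
    filter_upwards [haeU2] with q hq
    funext i
    have hu := Set.mem_univ_pi.1 hq.1 i
    have hv := Set.mem_univ_pi.1 hq.2 i
    have h := rq_rpit_rq (ν i) hu hv
    show rqe (ν i) (rpit (ν i) (rqe (ν i) (q.1 i)) (q.2 i)) = rqe (ν i) (q.1 i)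
    rw [rqe_of_mem _ hu, rqe_of_mem _ h.1, h.2]
  have h3' : ∀ᵐ q ∂μ₁.prod μ₁, F' (θ (T q.1) q.2) = f (T q.1) := by
    filter_upwards [h1, h2] with q hq1 hq2
    rw [hq2] at hq1; exact hq1
  have h3 : ∀ᵐ u ∂μ₁, ∀ᵐ v ∂μ₁, F' (θ (T u) v) = f (T u) :=
    Measure.ae_ae_of_ae_prod (p := fun q : (ι → ℝ) × (ι → ℝ) => F' (θ (T q.1) q.2) = f (T q.1)) h3'
  have hPm : MeasurableSet {q : (ι → ℝ) × (ι → ℝ) | F' (θ (T q.1) q.2) = f (T q.1)} :=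
    measurableSet_eq_fun (hF'm.comp (hθm.comp ((hTmp.measurable.comp measurable_fst).prodMk measurable_snd)))
      (hf.comp (hTmp.measurable.comp measurable_fst))
  have h3s : ∀ᵐ v ∂μ₁, ∀ᵐ u ∂μ₁, F' (θ (T u) v) = f (T u) :=
    (Measure.ae_ae_comm (μ := μ₁) (ν := μ₁) (p := fun u v => F' (θ (T u) v) = f (T u)) hPm).1 h3
  haveI : (ae μ₁).NeBot := ae_neBot.2 hμ₁0
  obtain ⟨v₀, hv₀U, hv₀⟩ := (haeU.and h3s).exists
  have hv₀' : ∀ i, v₀ i ∈ Icc (0 : ℝ) 1 := fun i => Ioo_subset_Icc_self (Set.mem_univ_pi.1 hv₀U i)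
  have hθlat : ∀ x y, θ (x ⊓ y) v₀ = θ x v₀ ⊓ θ y v₀ ∧ θ (x ⊔ y) v₀ = θ x v₀ ⊔ θ y v₀ := fun x y =>
    ⟨funext fun i => (rpit_mono_left (ν i) (hv₀' i)).map_inf (x i) (y i),
      funext fun i => (rpit_mono_left (ν i) (hv₀' i)).map_sup (x i) (y i)⟩
  have hθm' : Measurable fun x => θ x v₀ := hθm.comp (measurable_id.prodMk measurable_const)
  refine ⟨fun x => F' (θ x v₀), hF'm.comp hθm', fun x => hF'T _, ?_, fun x y => ?_⟩
  · rw [← hTmp.map_eq]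
    exact (ae_map_iff hTmp.measurable.aemeasurable (measurableSet_eq_fun (hF'm.comp hθm') hf)).2 hv₀
  · show F' (θ x v₀) * F' (θ y v₀) ≤ F' (θ (x ⊓ y) v₀) * F' (θ (x ⊔ y) v₀)
    rw [(hθlat x y).1, (hθlat x y).2]
    exact hF'mtp _ _

/-! ### Products of σ-finite measures; the plane -/

/-- **Lebesgue on `ℝ^ι` ⟹ every finite product of σ-finite measures on `ℝ` (atoms allowed)** for the finite-version
property. [this work] -/
theorem HasFiniteMTP2Versions.pi_of_volume' (hP : HasFiniteMTP2Versions (volume : Measure (ι → ℝ)))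
    (ρ : ι → Measure ℝ) [∀ i, SigmaFinite (ρ i)] : HasFiniteMTP2Versions (Measure.pi ρ) := by
  by_cases hz : ∃ i, ρ i = 0
  · obtain ⟨i, hi⟩ := hz
    have hpi : Measure.pi ρ = 0 := by
      rw [← Measure.measure_univ_eq_zero, Measure.pi_univ]
      exact Finset.prod_eq_zero (Finset.mem_univ i) (by rw [hi]; rfl)
    rw [hpi]
    exact hasFiniteMTP2Versions_zero
  · push Not at hz
    haveI : ∀ i, NeZero (ρ i) := fun i => ⟨hz i⟩
    set ν : ι → Measure ℝ := fun i => (ρ i).toFinite with hν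
    haveI : ∀ i, IsProbabilityMeasure (ν i) := fun i => by rw [hν]; infer_instance
    have hPν : HasFiniteMTP2Versions (Measure.pi ν) :=
      (hP.restrict_openUnitCube).pi_of_restrict_openUnitCube' ν
    exact hPν.of_equivalent (pi_absolutelyContinuous_pi_toFinite ρ) (pi_toFinite_absolutelyContinuous_pi ρ)

/-- **Every product of two σ-finite measures on `ℝ` has the finite-version property** (planar structure theorem +
transport; atoms allowed). [this work] -/
theorem hasFiniteMTP2Versions_pi_plane (ρ : Fin 2 → Measure ℝ) [∀ i, SigmaFinite (ρ i)] :
    HasFiniteMTP2Versions (Measure.pi ρ) :=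
  hasFiniteMTP2Versions_volume_plane.pi_of_volume' ρ

/-- **The planar structure theorem under a product reference measure.**  For σ-finite `ρ₀, ρ₁` on `ℝ` (atoms
allowed) and a measurable `f : ℝ² → (0, ∞)` (finite, non-zero, NO bounds) which is MTP₂ on
`(ρ₀ ⊗ ρ₁) ⊗ (ρ₀ ⊗ ρ₁)`-almost every pair, there is a finite Borel version `F = f` a.e. with
`F(x) F(y) ≤ F(x ∧ y) F(x ∨ y)` at EVERY pair (the version may vanish off the essential rectangle of `ρ₀ ⊗ ρ₁`).
[this work] -/
theorem Plane.exists_measurable_mtp2_version_of_ae_pi_plane (ρ : Fin 2 → Measure ℝ) [∀ i, SigmaFinite (ρ i)]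
    (f : (Fin 2 → ℝ) → ℝ≥0∞) (hf : Measurable f) (h0 : ∀ x, f x ≠ 0) (hT : ∀ x, f x ≠ ∞)
    (hMTP : ∀ᵐ p : (Fin 2 → ℝ) × (Fin 2 → ℝ) ∂(Measure.pi ρ).prod (Measure.pi ρ),
      f p.1 * f p.2 ≤ f (p.1 ⊓ p.2) * f (p.1 ⊔ p.2)) :
    ∃ F : (Fin 2 → ℝ) → ℝ≥0∞, Measurable F ∧ (∀ x, F x ≠ ∞) ∧ F =ᵐ[Measure.pi ρ] f ∧
      ∀ x y, F x * F y ≤ F (x ⊓ y) * F (x ⊔ y) :=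
  hasFiniteMTP2Versions_pi_plane ρ f hf h0 hT hMTP

/-- The same with `0 < f < ∞` assumed only almost everywhere. [this work] -/
theorem Plane.exists_measurable_mtp2_version_of_ae_pi_plane' (ρ : Fin 2 → Measure ℝ) [∀ i, SigmaFinite (ρ i)]
    (f : (Fin 2 → ℝ) → ℝ≥0∞) (hf : Measurable f) (hfin : ∀ᵐ x ∂Measure.pi ρ, f x ≠ 0 ∧ f x ≠ ∞)
    (hMTP : ∀ᵐ p : (Fin 2 → ℝ) × (Fin 2 → ℝ) ∂(Measure.pi ρ).prod (Measure.pi ρ),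
      f p.1 * f p.2 ≤ f (p.1 ⊓ p.2) * f (p.1 ⊔ p.2)) :
    ∃ F : (Fin 2 → ℝ) → ℝ≥0∞, Measurable F ∧ (∀ x, F x ≠ ∞) ∧ F =ᵐ[Measure.pi ρ] f ∧
      ∀ x y, F x * F y ≤ F (x ⊓ y) * F (x ⊔ y) := by
  set G : Set (Fin 2 → ℝ) := {x | f x ≠ 0 ∧ f x ≠ ∞} with hG
  have mG : MeasurableSet G :=
    (hf (measurableSet_singleton 0)).compl.inter (hf (measurableSet_singleton ∞)).compl
  set g : (Fin 2 → ℝ) → ℝ≥0∞ := G.piecewise f (fun _ => 1) with hg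
  have hgm : Measurable g := hf.piecewise mG measurable_const
  have hg_of_mem : ∀ x ∈ G, g x = f x := fun x hx => Set.piecewise_eq_of_mem _ _ _ hx
  have hg_of_not_mem : ∀ x ∉ G, g x = 1 := fun x hx => Set.piecewise_eq_of_notMem _ _ _ hx
  have hg0 : ∀ x, g x ≠ 0 := fun x => by
    by_cases hx : x ∈ G
    · rw [hg_of_mem x hx]; exact hx.1
    · rw [hg_of_not_mem x hx]; exact one_ne_zero
  have hgT : ∀ x, g x ≠ ∞ := fun x => by
    by_cases hx : x ∈ G
    · rw [hg_of_mem x hx]; exact hx.2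
    · rw [hg_of_not_mem x hx]; exact ENNReal.one_ne_top
  have hgf : g =ᵐ[Measure.pi ρ] f := by
    filter_upwards [hfin] with x hx using hg_of_mem x hx
  have hgMTP : ∀ᵐ p : (Fin 2 → ℝ) × (Fin 2 → ℝ) ∂(Measure.pi ρ).prod (Measure.pi ρ),
      g p.1 * g p.2 ≤ g (p.1 ⊓ p.2) * g (p.1 ⊔ p.2) := by
    filter_upwards [hMTP, ae_prod_mem_inf_sup_of_sigmaFinite ρ (G := G) hfin] with p hp hG4
    rw [hg_of_mem _ hG4.1.1, hg_of_mem _ hG4.1.2, hg_of_mem _ hG4.2.1, hg_of_mem _ hG4.2.2]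
    exact hp
  obtain ⟨F, hFm, hFb, hFg, hFmtp⟩ := hasFiniteMTP2Versions_pi_plane ρ g hgm hg0 hgT hgMTP
  exact ⟨F, hFm, hFb, hFg.trans hgf, hFmtp⟩

end Summit.CriticalPhenomena.PercolationContinuityZ3.Theorems.SahiAEFourFunctions
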